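import Literature.MathematicalPhysics.QuantumFieldTheory.Balaban1983to89.B3Taylor310LocalRemainder
import HarnessLib

/-!
# Crux `FluctuationComparisonRegPrIntL` (stmt-QuantumFields-20520, rung R3), PATH-B organ, v18 (H-currency): tool brick RM-PB —
# THE ROW MASS OF THE PULL-BACK LETTERS `k_c = C·Xᵀ k X + gᵀ Y` (abstract, DEFINITION-FREE; organ edition in the tree's row-mass spelling)

Cell `ym3-torus` (YM ladder rung R3 = continuum `SU(2)` Yang–Mills on the three-torus — a RUNG: NOT d = 4, NOT infinite volume, NOT a mass gap, NOT Clay).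
Width seat `ym3-torus-px19` (gen 19), helper on crux stmt-QuantumFields-20520 (`--kind proof --supports stmt-QuantumFields-20520 --as helper`, count-neutral,
no registry ∕ binder ∕ `Lines/` edit, default heartbeats, `autoImplicit false`).

WHAT THIS IS.  BRICK 2a (✓p805782 `…OrganTangentPullbackSquare`, LEAD `ym-ust-20520-w3` g25) pulls an H-clause back along displacement paths and ends
(§3 ★`secondDiff_pullback_letters`) with the COARSE pair letters
`k_c B B′ := C·Σ_{a c} Xl a B·k a c·Xl c B′ + Σ_d g d·Yl d B B′`
(`Xl` = first-order column letters, `Yl` = second-order letters, `k` = the fine pair letters, `g` = the fine gradient letters).  The LIN knit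
(LEAD census v4.1 §6: LINᵘ-H ⟸ SPREAD-TRANSPORT-H ∧ FIBRE-LAW-H ∧ ⟨seed clause⟩) must then exhibit the `∃ k′ ≥ 0, (∀ b, Σ_{b′} k′ b b′·e^{κ·d} ≤ w′) ∧ …`
block of LINᵘ-H's conclusion, i.e. it needs a ROW-MASS bound for `k_c` that carries NO volume factor.  THIS FILE is that bound, generically:

* §1 (abstract, 2a's index types `ι` (fine bonds) ∕ `ιc` (coarse bonds), nonnegative weights `ωf` (fine), `ωc` (coarse), `ωX` (cross-level) tied by the
  MULTIPLICATIVE TRIANGLE `ωc B B′ ≤ ωX a B·ωf a c·ωX c B′`): ★★`rowMass_pullback_letters` — column mass `Σ_a Xl a B·ωX a B ≤ Ncol`, row mass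
  `Σ_{B′} Xl c B′·ωX c B′ ≤ Nrow`, fine row mass `Σ_c k a c·ωf a c ≤ w`, `g ≤ G`, second-order mass `Σ_d Σ_{B′} Yl d B B′·ωc B B′ ≤ NY`
  ⟹ `Σ_{B′} k_c B B′·ωc B B′ ≤ C·(Ncol·w·Nrow) + G·NY` for every coarse bond `B` (Fubini + three nested monotone sums; weighted `ℓ¹`-operator-norm
  submultiplicativity).  Pieces: `rowMass_sandwich_le` (the bilinear part), `rowMass_gram_le` (the `k`-free Gram form `Σ_{B′}(XᵀX)_{BB′}·ωc ≤ Ncol·Nrow`,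
  ideator g27 №15's `N_T`), `rowMass_gradient_eq` ∕ `rowMass_gradient_le` (the second-order part), `pullbackLetters_nonneg`.
* §2 (organ edition, the tree's lattice vocabulary `Site`∕`PBond`∕`Site.tdist` of lit `Setup`): weights `ωf := exp(κ·tdist)` on the fine lattice `PBond Pf jf`,
  `ωc := exp(κ·tdist)` on the coarse lattice `PBond Pc jc` — spelled EXACTLY as the crux texts' row mass `∑ b', k b b' * Real.exp (κ * (b.src.tdist b'.src : ℝ))`
  (✓px19 Core `letter_le_rowMass`∕`rowMass_mono`, ✓cst-p1 KIT `rowMass_*` apply by name) — and `ωX := exp(κ·dX a B)` for ANY cross-level displacement distance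
  `dX` satisfying the one geometric hypothesis `tdist B.src B′.src ≤ dX a B + tdist a.src c.src + dX c B′`: ★★`rowMass_pullback_letters_exp`; and
  ★`rowMass_pullback_letters_proj`, where that hypothesis is DISCHARGED for `dX a B ≥ tdist (π a.src) B.src` along any map `π` of fine sites to coarse sites
  that does not increase `tdist` (a block projection), by lit ✓`B3Taylor310LocalRemainder.tdist_triangle`∕`tdist_comm`.

WHERE IT SITS.  With BRICK GA (LEAD, `…OrganTangentGradientFromAnalytic`: uniform gradient letters `g := Bρ∕rA` from the (β) clause) as the `G`, and the
SPREAD-TRANSPORT-H letters (ideator №15: `X` first order with m-uniform column∕row masses, `Y` second order) as `Ncol, Nrow, NY`, the conclusion is the row-mass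
conjunct of LINᵘ-H's output block for `k′ := k_c`, `w′ := C·Ncol·w·Nrow + G·NY`; the m-uniformity of `w′` is exactly the m-uniformity of `Ncol, Nrow, NY`.

HONEST FRAMING: real ∕ `Finset` bookkeeping over HYPOTHESIS letters; the displacement data, `dX`, `π` are NOT constructed here; nothing of Bałaban's analysis is
asserted or proved ([Balaban1984PropagatorsI] Prop 1.2 ∕ [Balaban1985Variational] Thm 1, (190) are where such letters would come from — LOCATE only);
LINᵘ-H ∕ JENᵘ-H ∕ O1ᵘ-H v2 ∕ S1aᴴ ∕ 26243 ∕ S2α′ ∕ S2β OPEN; crux 20520 `FluctuationComparisonRegPrIntL` ∕ `YM3TorusSU2` NOT proved; no summit ∕ sub-problem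
statement is proved; rung R3 = SU(2) YM₃ on T³ at fixed lattice data — NOT d = 4, NOT infinite volume, NOT a mass gap, NOT Clay; the Yang–Mills mass gap is NOT
proved.  [folklore] bookkeeping.
-/

set_option autoImplicit false

noncomputable section

namespace Summit.QuantumFields.YangMills.Theorems.OrganTangentPullbackRowMass

open scoped BigOperators
open Literature.MathematicalPhysics.QuantumFieldTheory.Balaban1983to89

/-! ## §1 Abstract: weighted row mass of `C·Xᵀ k X + gᵀ Y` -/

section Abstract

variable {ι ιc : Type*} [Fintype ι] [Fintype ιc]

omit [Fintype ιc] in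
/-- The pull-back letters `k_c B B′ = C·Σ_{a c} Xl a B·k a c·Xl c B′ + Σ_d g d·Yl d B B′` are nonnegative when all ingredients are. [folklore] -/
theorem pullbackLetters_nonneg (k : ι → ι → ℝ) (g : ι → ℝ) (C : ℝ) (Xl : ι → ιc → ℝ) (Yl : ι → ιc → ιc → ℝ)
    (hk : ∀ a c, 0 ≤ k a c) (hg : ∀ d, 0 ≤ g d) (hC : 0 ≤ C) (hX : ∀ a B, 0 ≤ Xl a B) (hY : ∀ d B B', 0 ≤ Yl d B B')
    (B B' : ιc) :
    0 ≤ C * ∑ a, ∑ c, Xl a B * k a c * Xl c B' + ∑ d, g d * Yl d B B' :=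
  add_nonneg (mul_nonneg hC (Finset.sum_nonneg fun a _ => Finset.sum_nonneg fun c _ =>
    mul_nonneg (mul_nonneg (hX a B) (hk a c)) (hX c B')))
    (Finset.sum_nonneg fun d _ => mul_nonneg (hg d) (hY d B B'))

/-- Fubini for the sandwich: `Σ_{B′} Σ_a Σ_c p a·q a c·r c B′ = Σ_a p a·Σ_c q a c·Σ_{B′} r c B′`. [folklore] -/
theorem sum_sandwich_eq (p : ι → ℝ) (q : ι → ι → ℝ) (r : ι → ιc → ℝ) :
    ∑ B', ∑ a, ∑ c, p a * q a c * r c B' = ∑ a, p a * ∑ c, q a c * ∑ B', r c B' := by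
  calc ∑ B', ∑ a, ∑ c, p a * q a c * r c B'
      = ∑ a, ∑ B', ∑ c, p a * q a c * r c B' := Finset.sum_comm
    _ = ∑ a, ∑ c, ∑ B', p a * q a c * r c B' := Finset.sum_congr rfl fun a _ => Finset.sum_comm
    _ = ∑ a, p a * ∑ c, q a c * ∑ B', r c B' := by
        refine Finset.sum_congr rfl fun a _ => ?_
        rw [Finset.mul_sum]
        refine Finset.sum_congr rfl fun c _ => ?_
        rw [Finset.mul_sum, Finset.mul_sum]
        exact Finset.sum_congr rfl fun B' _ => by ring

/-- ★ **ROW MASS OF THE BILINEAR PART** (weighted `ℓ¹`-operator-norm submultiplicativity): under the multiplicative triangle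
`ωc B B′ ≤ ωX a B·ωf a c·ωX c B′`, a column mass `Ncol` and a row mass `Nrow` of `Xl` (w.r.t. `ωX`) and a row mass `w` of `k` (w.r.t. `ωf`) give
`Σ_{B′} (Σ_{a c} Xl a B·k a c·Xl c B′)·ωc B B′ ≤ Ncol·w·Nrow`. [folklore] -/
theorem rowMass_sandwich_le (k : ι → ι → ℝ) (Xl : ι → ιc → ℝ) (ωf : ι → ι → ℝ) (ωc : ιc → ιc → ℝ) (ωX : ι → ιc → ℝ)
    (hk : ∀ a c, 0 ≤ k a c) (hX : ∀ a B, 0 ≤ Xl a B) (hωf : ∀ a c, 0 ≤ ωf a c) (hωX : ∀ a B, 0 ≤ ωX a B)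
    (htri : ∀ (B B' : ιc) (a c : ι), ωc B B' ≤ ωX a B * ωf a c * ωX c B')
    {Ncol Nrow w : ℝ} (hw : 0 ≤ w) (hNrow : 0 ≤ Nrow)
    (hcol : ∀ B, ∑ a, Xl a B * ωX a B ≤ Ncol) (hrow : ∀ c, ∑ B', Xl c B' * ωX c B' ≤ Nrow)
    (hkrow : ∀ a, ∑ c, k a c * ωf a c ≤ w) (B : ιc) :
    ∑ B', (∑ a, ∑ c, Xl a B * k a c * Xl c B') * ωc B B' ≤ Ncol * w * Nrow := by
  have step1 : ∑ B', (∑ a, ∑ c, Xl a B * k a c * Xl c B') * ωc B B'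
      ≤ ∑ B', ∑ a, ∑ c, (Xl a B * ωX a B) * (k a c * ωf a c) * (Xl c B' * ωX c B') := by
    refine Finset.sum_le_sum fun B' _ => ?_
    rw [Finset.sum_mul]
    refine Finset.sum_le_sum fun a _ => ?_
    rw [Finset.sum_mul]
    refine Finset.sum_le_sum fun c _ => ?_
    calc Xl a B * k a c * Xl c B' * ωc B B'
        ≤ Xl a B * k a c * Xl c B' * (ωX a B * ωf a c * ωX c B') :=
          mul_le_mul_of_nonneg_left (htri B B' a c) (mul_nonneg (mul_nonneg (hX a B) (hk a c)) (hX c B'))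
      _ = (Xl a B * ωX a B) * (k a c * ωf a c) * (Xl c B' * ωX c B') := by ring
  rw [sum_sandwich_eq (fun a => Xl a B * ωX a B) (fun a c => k a c * ωf a c) (fun c B' => Xl c B' * ωX c B')] at step1
  refine step1.trans ?_
  have step2 : ∀ a, (Xl a B * ωX a B) * ∑ c, (k a c * ωf a c) * ∑ B', Xl c B' * ωX c B' ≤ (Xl a B * ωX a B) * (w * Nrow) := by
    intro a
    refine mul_le_mul_of_nonneg_left ?_ (mul_nonneg (hX a B) (hωX a B))
    calc ∑ c, (k a c * ωf a c) * ∑ B', Xl c B' * ωX c B'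
        ≤ ∑ c, (k a c * ωf a c) * Nrow :=
          Finset.sum_le_sum fun c _ => mul_le_mul_of_nonneg_left (hrow c) (mul_nonneg (hk a c) (hωf a c))
      _ = (∑ c, k a c * ωf a c) * Nrow := by rw [Finset.sum_mul]
      _ ≤ w * Nrow := mul_le_mul_of_nonneg_right (hkrow a) hNrow
  calc ∑ a, (Xl a B * ωX a B) * ∑ c, (k a c * ωf a c) * ∑ B', Xl c B' * ωX c B'
      ≤ ∑ a, (Xl a B * ωX a B) * (w * Nrow) := Finset.sum_le_sum fun a _ => step2 a
    _ = (∑ a, Xl a B * ωX a B) * (w * Nrow) := by rw [Finset.sum_mul]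
    _ ≤ Ncol * (w * Nrow) := mul_le_mul_of_nonneg_right (hcol B) (mul_nonneg hw hNrow)
    _ = Ncol * w * Nrow := by ring

/-- The `k`-free GRAM form (ideator g27 №15's `Σ_{B′}(XᵀX)_{BB′}e^{κd} ≤ N_T`): under `ωc B B′ ≤ ωX a B·ωX a B′`,
`Σ_{B′} (Σ_a Xl a B·Xl a B′)·ωc B B′ ≤ Ncol·Nrow`. [folklore] -/
theorem rowMass_gram_le (Xl : ι → ιc → ℝ) (ωc : ιc → ιc → ℝ) (ωX : ι → ιc → ℝ)
    (hX : ∀ a B, 0 ≤ Xl a B) (hωX : ∀ a B, 0 ≤ ωX a B)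
    (htri : ∀ (B B' : ιc) (a : ι), ωc B B' ≤ ωX a B * ωX a B')
    {Ncol Nrow : ℝ} (hNrow : 0 ≤ Nrow)
    (hcol : ∀ B, ∑ a, Xl a B * ωX a B ≤ Ncol) (hrow : ∀ c, ∑ B', Xl c B' * ωX c B' ≤ Nrow) (B : ιc) :
    ∑ B', (∑ a, Xl a B * Xl a B') * ωc B B' ≤ Ncol * Nrow := by
  have step1 : ∑ B', (∑ a, Xl a B * Xl a B') * ωc B B' ≤ ∑ B', ∑ a, (Xl a B * ωX a B) * (Xl a B' * ωX a B') := by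
    refine Finset.sum_le_sum fun B' _ => ?_
    rw [Finset.sum_mul]
    refine Finset.sum_le_sum fun a _ => ?_
    calc Xl a B * Xl a B' * ωc B B'
        ≤ Xl a B * Xl a B' * (ωX a B * ωX a B') := mul_le_mul_of_nonneg_left (htri B B' a) (mul_nonneg (hX a B) (hX a B'))
      _ = (Xl a B * ωX a B) * (Xl a B' * ωX a B') := by ring
  refine step1.trans ?_
  rw [Finset.sum_comm]
  calc ∑ a, ∑ B', (Xl a B * ωX a B) * (Xl a B' * ωX a B')
      = ∑ a, (Xl a B * ωX a B) * ∑ B', Xl a B' * ωX a B' := Finset.sum_congr rfl fun a _ => by rw [Finset.mul_sum]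
    _ ≤ ∑ a, (Xl a B * ωX a B) * Nrow := Finset.sum_le_sum fun a _ => mul_le_mul_of_nonneg_left (hrow a) (mul_nonneg (hX a B) (hωX a B))
    _ = (∑ a, Xl a B * ωX a B) * Nrow := by rw [Finset.sum_mul]
    _ ≤ Ncol * Nrow := mul_le_mul_of_nonneg_right (hcol B) hNrow

/-- Fubini for the second-order part: `Σ_{B′} (Σ_d g d·Yl d B B′)·ωc B B′ = Σ_d g d·(Σ_{B′} Yl d B B′·ωc B B′)`. [folklore] -/
theorem rowMass_gradient_eq (g : ι → ℝ) (Yl : ι → ιc → ιc → ℝ) (ωc : ιc → ιc → ℝ) (B : ιc) :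
    ∑ B', (∑ d, g d * Yl d B B') * ωc B B' = ∑ d, g d * ∑ B', Yl d B B' * ωc B B' := by
  calc ∑ B', (∑ d, g d * Yl d B B') * ωc B B'
      = ∑ B', ∑ d, g d * (Yl d B B' * ωc B B') := by
        refine Finset.sum_congr rfl fun B' _ => ?_
        rw [Finset.sum_mul]
        exact Finset.sum_congr rfl fun d _ => by ring
    _ = ∑ d, ∑ B', g d * (Yl d B B' * ωc B B') := Finset.sum_comm
    _ = ∑ d, g d * ∑ B', Yl d B B' * ωc B B' := Finset.sum_congr rfl fun d _ => by rw [Finset.mul_sum]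

/-- ★ **ROW MASS OF THE SECOND-ORDER PART** with a UNIFORM gradient bound `g ≤ G` (BRICK GA's `Bρ∕rA`) and a second-order mass
`Σ_d Σ_{B′} Yl d B B′·ωc B B′ ≤ NY`: `Σ_{B′} (Σ_d g d·Yl d B B′)·ωc B B′ ≤ G·NY`. [folklore] -/
theorem rowMass_gradient_le (g : ι → ℝ) (Yl : ι → ιc → ιc → ℝ) (ωc : ιc → ιc → ℝ)
    (hY : ∀ d B B', 0 ≤ Yl d B B') (hωc : ∀ B B', 0 ≤ ωc B B')
    {G NY : ℝ} (hG0 : 0 ≤ G) (hG : ∀ d, g d ≤ G) (hYmass : ∀ B, ∑ d, ∑ B', Yl d B B' * ωc B B' ≤ NY) (B : ιc) :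
    ∑ B', (∑ d, g d * Yl d B B') * ωc B B' ≤ G * NY := by
  rw [rowMass_gradient_eq]
  calc ∑ d, g d * ∑ B', Yl d B B' * ωc B B'
      ≤ ∑ d, G * ∑ B', Yl d B B' * ωc B B' :=
        Finset.sum_le_sum fun d _ => mul_le_mul_of_nonneg_right (hG d)
          (Finset.sum_nonneg fun B' _ => mul_nonneg (hY d B B') (hωc B B'))
    _ = G * ∑ d, ∑ B', Yl d B B' * ωc B B' := by rw [Finset.mul_sum]
    _ ≤ G * NY := mul_le_mul_of_nonneg_left (hYmass B) hG0

/-- ★★ **ROW MASS OF THE PULL-BACK LETTERS** `k_c = C·Xᵀ k X + gᵀ Y` (BRICK 2a ✓p805782 `secondDiff_pullback_letters`' coefficient, verbatim shape):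
`Σ_{B′} k_c B B′·ωc B B′ ≤ C·(Ncol·w·Nrow) + G·NY` — no volume factor. [folklore] -/
theorem rowMass_pullback_letters (k : ι → ι → ℝ) (g : ι → ℝ) (C : ℝ) (Xl : ι → ιc → ℝ) (Yl : ι → ιc → ιc → ℝ)
    (ωf : ι → ι → ℝ) (ωc : ιc → ιc → ℝ) (ωX : ι → ιc → ℝ)
    (hk : ∀ a c, 0 ≤ k a c) (hC : 0 ≤ C) (hX : ∀ a B, 0 ≤ Xl a B) (hY : ∀ d B B', 0 ≤ Yl d B B')
    (hωf : ∀ a c, 0 ≤ ωf a c) (hωc : ∀ B B', 0 ≤ ωc B B') (hωX : ∀ a B, 0 ≤ ωX a B)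
    (htri : ∀ (B B' : ιc) (a c : ι), ωc B B' ≤ ωX a B * ωf a c * ωX c B')
    {Ncol Nrow w G NY : ℝ} (hw : 0 ≤ w) (hNrow : 0 ≤ Nrow) (hG0 : 0 ≤ G)
    (hcol : ∀ B, ∑ a, Xl a B * ωX a B ≤ Ncol) (hrow : ∀ c, ∑ B', Xl c B' * ωX c B' ≤ Nrow)
    (hkrow : ∀ a, ∑ c, k a c * ωf a c ≤ w) (hG : ∀ d, g d ≤ G)
    (hYmass : ∀ B, ∑ d, ∑ B', Yl d B B' * ωc B B' ≤ NY) (B : ιc) :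
    ∑ B', (C * ∑ a, ∑ c, Xl a B * k a c * Xl c B' + ∑ d, g d * Yl d B B') * ωc B B' ≤ C * (Ncol * w * Nrow) + G * NY := by
  have hsplit : ∑ B', (C * ∑ a, ∑ c, Xl a B * k a c * Xl c B' + ∑ d, g d * Yl d B B') * ωc B B'
      = C * ∑ B', (∑ a, ∑ c, Xl a B * k a c * Xl c B') * ωc B B' + ∑ B', (∑ d, g d * Yl d B B') * ωc B B' := by
    rw [Finset.mul_sum, ← Finset.sum_add_distrib]
    exact Finset.sum_congr rfl fun B' _ => by ring
  rw [hsplit]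
  exact add_le_add
    (mul_le_mul_of_nonneg_left (rowMass_sandwich_le k Xl ωf ωc ωX hk hX hωf hωX htri hw hNrow hcol hrow hkrow B) hC)
    (rowMass_gradient_le g Yl ωc hY hωc hG0 hG hYmass B)

end Abstract

/-! ## §2 Organ edition: exponential weights in the tree's row-mass spelling -/

section Organ

variable {Pf Pc : Params} {jf jc : ℕ}

/-- The multiplicative triangle for exponential weights from an additive triangle of distances (`0 ≤ κ`). [folklore] -/
theorem exp_weight_triangle {κ : ℝ} (hκ : 0 ≤ κ) {tc dX₁ tf dX₂ : ℝ} (hd : tc ≤ dX₁ + tf + dX₂) :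
    Real.exp (κ * tc) ≤ Real.exp (κ * dX₁) * Real.exp (κ * tf) * Real.exp (κ * dX₂) := by
  rw [← Real.exp_add, ← Real.exp_add]
  refine Real.exp_le_exp.2 ?_
  have := mul_le_mul_of_nonneg_left hd hκ
  linarith [this]

/-- ★★ **ROW MASS OF THE PULL-BACK LETTERS, ORGAN EDITION**: fine bonds `PBond Pf jf` (height `Ts`), coarse bonds `PBond Pc jc` (height `j`), weights
`exp(κ·tdist)` on each lattice spelled as in the crux texts' row mass, and `exp(κ·dX a B)` across, for ANY cross-level displacement distance `dX` with
`tdist B.src B′.src ≤ dX a B + tdist a.src c.src + dX c B′`.  Conclusion = the row-mass conjunct of LINᵘ-H's output block for `k′ := k_c`,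
`w′ := C·(Ncol·w·Nrow) + G·NY`. [folklore] -/
theorem rowMass_pullback_letters_exp (κ : ℝ) (hκ : 0 ≤ κ)
    (k : PBond Pf jf → PBond Pf jf → ℝ) (g : PBond Pf jf → ℝ) (C : ℝ)
    (Xl : PBond Pf jf → PBond Pc jc → ℝ) (Yl : PBond Pf jf → PBond Pc jc → PBond Pc jc → ℝ) (dX : PBond Pf jf → PBond Pc jc → ℝ)
    (hk : ∀ a c, 0 ≤ k a c) (hC : 0 ≤ C) (hX : ∀ a B, 0 ≤ Xl a B) (hY : ∀ d B B', 0 ≤ Yl d B B')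
    (hd : ∀ (B B' : PBond Pc jc) (a c : PBond Pf jf),
      (B.src.tdist B'.src : ℝ) ≤ dX a B + (a.src.tdist c.src : ℝ) + dX c B')
    {Ncol Nrow w G NY : ℝ} (hw : 0 ≤ w) (hNrow : 0 ≤ Nrow) (hG0 : 0 ≤ G)
    (hcol : ∀ B, ∑ a, Xl a B * Real.exp (κ * dX a B) ≤ Ncol)
    (hrow : ∀ c, ∑ B', Xl c B' * Real.exp (κ * dX c B') ≤ Nrow)
    (hkrow : ∀ a, ∑ c, k a c * Real.exp (κ * (a.src.tdist c.src : ℝ)) ≤ w)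
    (hG : ∀ d, g d ≤ G)
    (hYmass : ∀ B, ∑ d, ∑ B', Yl d B B' * Real.exp (κ * (B.src.tdist B'.src : ℝ)) ≤ NY) :
    ∀ B : PBond Pc jc,
      ∑ B', (C * ∑ a, ∑ c, Xl a B * k a c * Xl c B' + ∑ d, g d * Yl d B B') * Real.exp (κ * (B.src.tdist B'.src : ℝ))
        ≤ C * (Ncol * w * Nrow) + G * NY :=
  fun B => rowMass_pullback_letters k g C Xl Yl
    (fun a c => Real.exp (κ * (a.src.tdist c.src : ℝ))) (fun B B' => Real.exp (κ * (B.src.tdist B'.src : ℝ)))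
    (fun a B => Real.exp (κ * dX a B)) hk hC hX hY (fun _ _ => Real.exp_nonneg _) (fun _ _ => Real.exp_nonneg _)
    (fun _ _ => Real.exp_nonneg _) (fun B B' a c => exp_weight_triangle hκ (hd B B' a c)) hw hNrow hG0 hcol hrow hkrow hG hYmass B

/-- The geometric hypothesis DISCHARGED along a block projection: if `π` maps fine sites to coarse sites without increasing `tdist` and the displacement
distance dominates the coarse distance to the projected source, `dX a B ≥ tdist (π a.src) B.src`, then
`tdist B.src B′.src ≤ dX a B + tdist a.src c.src + dX c B′` (lit ✓`tdist_triangle`, ✓`tdist_comm`). [folklore] -/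
theorem dist_triangle_of_proj (π : Site Pf jf → Site Pc jc) (hπ : ∀ x y : Site Pf jf, (π x).tdist (π y) ≤ x.tdist y)
    (dX : PBond Pf jf → PBond Pc jc → ℝ) (hdX : ∀ (a : PBond Pf jf) (B : PBond Pc jc), ((π a.src).tdist B.src : ℝ) ≤ dX a B)
    (B B' : PBond Pc jc) (a c : PBond Pf jf) :
    (B.src.tdist B'.src : ℝ) ≤ dX a B + (a.src.tdist c.src : ℝ) + dX c B' := by
  have t1 := B3Taylor310LocalRemainder.tdist_triangle B.src (π a.src) B'.src
  have t2 := B3Taylor310LocalRemainder.tdist_triangle (π a.src) (π c.src) B'.src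
  have h1 : B.src.tdist B'.src ≤ B.src.tdist (π a.src) + (π a.src).tdist (π c.src) + (π c.src).tdist B'.src := by omega
  have h2 : (π a.src).tdist (π c.src) ≤ a.src.tdist c.src := hπ a.src c.src
  have h3 : (B.src.tdist (π a.src) : ℝ) ≤ dX a B := by
    rw [B3Taylor310LocalRemainder.tdist_comm]; exact hdX a B
  have h4 : ((π c.src).tdist B'.src : ℝ) ≤ dX c B' := hdX c B'
  have h1' : (B.src.tdist B'.src : ℝ) ≤ (B.src.tdist (π a.src) : ℝ) + ((π a.src).tdist (π c.src) : ℝ) + ((π c.src).tdist B'.src : ℝ) := by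
    exact_mod_cast h1
  have h2' : ((π a.src).tdist (π c.src) : ℝ) ≤ (a.src.tdist c.src : ℝ) := by exact_mod_cast h2
  linarith

/-- ★ **ORGAN EDITION ALONG A BLOCK PROJECTION**: `rowMass_pullback_letters_exp` with its geometric hypothesis discharged by `dist_triangle_of_proj`. [folklore] -/
theorem rowMass_pullback_letters_proj (κ : ℝ) (hκ : 0 ≤ κ)
    (π : Site Pf jf → Site Pc jc) (hπ : ∀ x y : Site Pf jf, (π x).tdist (π y) ≤ x.tdist y)
    (k : PBond Pf jf → PBond Pf jf → ℝ) (g : PBond Pf jf → ℝ) (C : ℝ)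
    (Xl : PBond Pf jf → PBond Pc jc → ℝ) (Yl : PBond Pf jf → PBond Pc jc → PBond Pc jc → ℝ) (dX : PBond Pf jf → PBond Pc jc → ℝ)
    (hk : ∀ a c, 0 ≤ k a c) (hC : 0 ≤ C) (hX : ∀ a B, 0 ≤ Xl a B) (hY : ∀ d B B', 0 ≤ Yl d B B')
    (hdX : ∀ (a : PBond Pf jf) (B : PBond Pc jc), ((π a.src).tdist B.src : ℝ) ≤ dX a B)
    {Ncol Nrow w G NY : ℝ} (hw : 0 ≤ w) (hNrow : 0 ≤ Nrow) (hG0 : 0 ≤ G)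
    (hcol : ∀ B, ∑ a, Xl a B * Real.exp (κ * dX a B) ≤ Ncol)
    (hrow : ∀ c, ∑ B', Xl c B' * Real.exp (κ * dX c B') ≤ Nrow)
    (hkrow : ∀ a, ∑ c, k a c * Real.exp (κ * (a.src.tdist c.src : ℝ)) ≤ w)
    (hG : ∀ d, g d ≤ G)
    (hYmass : ∀ B, ∑ d, ∑ B', Yl d B B' * Real.exp (κ * (B.src.tdist B'.src : ℝ)) ≤ NY) :
    ∀ B : PBond Pc jc,
      ∑ B', (C * ∑ a, ∑ c, Xl a B * k a c * Xl c B' + ∑ d, g d * Yl d B B') * Real.exp (κ * (B.src.tdist B'.src : ℝ))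
        ≤ C * (Ncol * w * Nrow) + G * NY :=
  rowMass_pullback_letters_exp κ hκ k g C Xl Yl dX hk hC hX hY (dist_triangle_of_proj π hπ dX hdX) hw hNrow hG0 hcol hrow hkrow hG hYmass

end Organ

end Summit.QuantumFields.YangMills.Theorems.OrganTangentPullbackRowMass

end
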